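import Literature.NumberTheory.Automorphic.HeckeCommonEigenvector
import HarnessLib

/-!
# Eigenvalues of `Z Y + X` from a push–pull pair `Y X = q`: the factorisation `a₁ = q ζ μ⁻¹ + μ`, `a₂ = ζ`

Topic `NumberTheory/Automorphic`; namespace `Literature.NumberTheory.Automorphic`.  Theorems only
(linear algebra over an algebraically closed field; the tree's
`exists_common_eigenvector_of_forall_comm` of `HeckeCommonEigenvector`).

**Setting** (the cohomology of the Borel stratum of a `GL₂`-arithmetic quotient at the good
places `w`, [Harder1987, §2]): on a FINITE-DIMENSIONAL space `H` we are given, for each index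
`w`, endomorphisms `X_w` (`= T^B_{diag(1,ϖ_w)}`, pull-back along a `q_w`-to-one map),
`Y_w` (`= T^B_{diag(1,ϖ_w)⁻¹}`, the push-forward) and `Z_w` (`= T_{ϖ_w · 1}`, central) with

* the push–pull relation `Y_w X_w = q_w · id`, `q_w ≠ 0` (`HeckeContractingElement`);
* `X`'s and `Z`'s commuting among each other (different places commute; `Z` central);

and a non-zero `y ∈ H` which is, eventually along a filter `l` in `w`, an eigenvector of the
`GL₂`-Hecke operators `T_{w,1} = Z_w Y_w + X_w` (eigenvalue `a_{w,1}`) and `T_{w,2} = Z_w`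
(eigenvalue `a_{w,2}`).

**Conclusion** (`exists_pushPull_eigenvalues`): there are a non-zero SIMULTANEOUS eigenvector
`y₀` of all the `X_w, Z_w` — `X_w y₀ = μ_w y₀`, `Z_w y₀ = ζ_w y₀`, all `μ_w ≠ 0` — and,
eventually along `l`,

`a_{w,1} = q_w ζ_w μ_w⁻¹ + μ_w`, `a_{w,2} = ζ_w`,

i.e. `X² − a_{w,1} X + q_w a_{w,2} = (X − q_w ζ_w μ_w⁻¹)(X − μ_w)`
(`heckeQuadratic_eq_mul`): the Hecke polynomial at `w` of a boundary eigenclass SPLITS with roots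
`q_w χ₁(ϖ_w)`, `χ₂(ϖ_w)` for `χ₂(ϖ_w) := μ_w`, `χ₁(ϖ_w) := ζ_w μ_w⁻¹` — the shape
"`{q_w χ₁(ϖ_w), χ₂(ϖ_w)}`" of the Satake parameters of an induced representation, obtained here
by pure linear algebra: finite-dimensionality makes the injective `X_w` invertible, forces
`Y_w = q_w X_w⁻¹` (so that everything commutes), and a minimal invariant subspace of the joint
eigenspace of the `T_{w,i}` is a joint eigenline of the `X_w, Z_w`.

## References

* G. Harder, *Eisenstein cohomology of arithmetic groups. The case GL₂*, Invent. Math. 89 (1987), §2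
  [Harder1987].
* D. Bump, *Automorphic forms and representations* (1997), proof of Thm. 3.4.4 (simultaneous
  eigenvectors of commuting Hecke operators) [Bump1997].
-/

noncomputable section

namespace Literature.NumberTheory.Automorphic

variable {E : Type*} [Field E] {H : Type*} [AddCommGroup H] [Module E H]

/-! ### Push–pull pairs on a finite-dimensional space -/

/-- A push–pull pair `Y X = q`, `q ≠ 0`, has `X` injective. [folklore] -/
theorem injective_of_pushPull {X Y : Module.End E H} {q : E} (hYX : Y ∘ₗ X = q • LinearMap.id)
    (hq : q ≠ 0) : Function.Injective X := by
  intro u v huv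
  have h := congrArg Y huv
  have hu := LinearMap.congr_fun hYX u
  have hv := LinearMap.congr_fun hYX v
  simp only [LinearMap.comp_apply, LinearMap.smul_apply, LinearMap.id_apply] at hu hv
  rw [hu, hv] at h
  exact smul_right_injective H hq h

variable [FiniteDimensional E H]

/-- On a finite-dimensional space a push–pull pair has `X` bijective. [folklore] -/
theorem bijective_of_pushPull {X Y : Module.End E H} {q : E} (hYX : Y ∘ₗ X = q • LinearMap.id)
    (hq : q ≠ 0) : Function.Bijective X :=
  ⟨injective_of_pushPull hYX hq,
    LinearMap.injective_iff_surjective.1 (injective_of_pushPull hYX hq)⟩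

/-- **`Y = q X⁻¹`**: on a finite-dimensional space the push-forward is determined by the
pull-back, `Y v = q • X⁻¹ v`. [folklore] -/
theorem pushPull_apply_eq {X Y : Module.End E H} {q : E} (hYX : Y ∘ₗ X = q • LinearMap.id)
    (hq : q ≠ 0) (v : H) :
    Y v = q • (LinearEquiv.ofBijective X (bijective_of_pushPull hYX hq)).symm v := by
  set e := LinearEquiv.ofBijective X (bijective_of_pushPull hYX hq)
  conv_lhs => rw [← e.apply_symm_apply v]
  rw [LinearEquiv.ofBijective_apply]
  have := LinearMap.congr_fun hYX (e.symm v)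
  simpa using this

omit [FiniteDimensional E H] in
/-- An endomorphism commuting with `X` commutes with `X⁻¹`. [folklore] -/
theorem apply_symm_of_comm {X T : Module.End E H} (hX : Function.Bijective X)
    (hcomm : ∀ v, T (X v) = X (T v)) (v : H) :
    T ((LinearEquiv.ofBijective X hX).symm v) = (LinearEquiv.ofBijective X hX).symm (T v) := by
  apply hX.1
  change X (T _) = (LinearEquiv.ofBijective X hX) ((LinearEquiv.ofBijective X hX).symm (T v))
  rw [LinearEquiv.apply_symm_apply, ← hcomm]
  change T ((LinearEquiv.ofBijective X hX) ((LinearEquiv.ofBijective X hX).symm v)) = T v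
  rw [LinearEquiv.apply_symm_apply]

/-- Hence an endomorphism commuting with `X` commutes with `Y = q X⁻¹`. [folklore] -/
theorem pushPull_comm {X Y T : Module.End E H} {q : E} (hYX : Y ∘ₗ X = q • LinearMap.id)
    (hq : q ≠ 0) (hcomm : ∀ v, T (X v) = X (T v)) (v : H) : T (Y v) = Y (T v) := by
  rw [pushPull_apply_eq hYX hq, pushPull_apply_eq hYX hq, map_smul,
    apply_symm_of_comm (bijective_of_pushPull hYX hq) hcomm]

omit [FiniteDimensional E H] in
/-- `X⁻¹` of an `X`-eigenvector: `X y = μ y`, `μ ≠ 0` gives `Y y = (q μ⁻¹) y`. [folklore] -/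
theorem pushPull_apply_of_eigen {X Y : Module.End E H} {q : E} (hYX : Y ∘ₗ X = q • LinearMap.id)
    {y : H} {μ : E} (hμ : μ ≠ 0) (hy : X y = μ • y) : Y y = (q * μ⁻¹) • y := by
  have h : X (μ⁻¹ • y) = y := by rw [map_smul, hy, smul_smul, inv_mul_cancel₀ hμ, one_smul]
  have := LinearMap.congr_fun hYX (μ⁻¹ • y)
  simp only [LinearMap.comp_apply, h, LinearMap.smul_apply, LinearMap.id_apply] at this
  rw [this, smul_smul]

/-! ### The eigenvalue factorisation -/

variable [IsAlgClosed E]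

/-- **Eigenvalues of `Z Y + X` and `Z` factor through a simultaneous eigenvector of `X` and `Z`.**
Let `X_w, Y_w, Z_w` (`w ∈ W`) be endomorphisms of a finite-dimensional space over an
algebraically closed field with `Y_w X_w = q_w ≠ 0`, the `X`'s and `Z`'s commuting among each
other, and let `y ≠ 0` satisfy `(Z_w Y_w + X_w) y = a₁(w) y`, `Z_w y = a₂(w) y` eventually along
`l`.  Then there are `y₀ ≠ 0` and scalars `μ_w ≠ 0`, `ζ_w` with `X_w y₀ = μ_w y₀`, `Z_w y₀ = ζ_w y₀`
for ALL `w`, and `a₁(w) = q_w ζ_w μ_w⁻¹ + μ_w`, `a₂(w) = ζ_w` eventually along `l`.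
[cite: Harder1987, §2] -/
theorem exists_pushPull_eigenvalues {W : Type*} (l : Filter W) (X Y Z : W → Module.End E H)
    (q : W → E) (hYX : ∀ w, Y w ∘ₗ X w = q w • LinearMap.id) (hq : ∀ w, q w ≠ 0)
    (hXX : ∀ w w' (v : H), X w (X w' v) = X w' (X w v))
    (hXZ : ∀ w w' (v : H), X w (Z w' v) = Z w' (X w v))
    (hZZ : ∀ w w' (v : H), Z w (Z w' v) = Z w' (Z w v))
    {y : H} (hy : y ≠ 0) (a₁ a₂ : W → E)
    (h : ∀ᶠ w in l, (Z w ∘ₗ Y w + X w) y = a₁ w • y ∧ Z w y = a₂ w • y) :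
    ∃ (y₀ : H) (μ ζ : W → E), y₀ ≠ 0 ∧ (∀ w, X w y₀ = μ w • y₀) ∧ (∀ w, Z w y₀ = ζ w • y₀) ∧
      (∀ w, μ w ≠ 0) ∧ ∀ᶠ w in l, a₁ w = q w * ζ w * (μ w)⁻¹ + μ w ∧ a₂ w = ζ w := by
  classical
  -- the set of good indices for `y` and the joint eigenspace it cuts out
  let S : Set W := {w | (Z w ∘ₗ Y w + X w) y = a₁ w • y ∧ Z w y = a₂ w • y}
  have hS : S ∈ l := h
  let M : Submodule E H :=
    ⨅ w ∈ S, LinearMap.ker (Z w ∘ₗ Y w + X w - a₁ w • LinearMap.id) ⊓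
      LinearMap.ker (Z w - a₂ w • LinearMap.id)
  have hmemM : ∀ v : H, v ∈ M ↔ ∀ w ∈ S, (Z w ∘ₗ Y w + X w) v = a₁ w • v ∧ Z w v = a₂ w • v := by
    intro v
    simp only [M, Submodule.mem_iInf, Submodule.mem_inf, LinearMap.mem_ker, LinearMap.sub_apply,
      LinearMap.smul_apply, LinearMap.id_apply, sub_eq_zero]
  have hyM : y ∈ M := (hmemM y).2 fun w hw => hw
  have hM : M ≠ ⊥ := fun hbot => hy ((Submodule.mem_bot E).1 (hbot ▸ hyM))
  -- everything commutes with the `T_{w,i}`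
  have hYcommX : ∀ w w' (v : H), X w' (Y w v) = Y w (X w' v) := fun w w' v =>
    pushPull_comm (hYX w) (hq w) (fun u => hXX w' w u) v
  have hYcommZ : ∀ w w' (v : H), Z w' (Y w v) = Y w (Z w' v) := fun w w' v =>
    pushPull_comm (hYX w) (hq w) (fun u => (hXZ w w' u).symm) v
  let 𝒮 : Set (Module.End E H) := Set.range X ∪ Set.range Z
  have hstab : ∀ T ∈ 𝒮, ∀ m ∈ M, T m ∈ M := by
    rintro T (⟨w', rfl⟩ | ⟨w', rfl⟩) m hm <;> rw [hmemM] at hm ⊢ <;> intro w hw <;>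
      obtain ⟨h1, h2⟩ := hm w hw
    · refine ⟨?_, ?_⟩
      · simp only [LinearMap.add_apply, LinearMap.comp_apply] at h1 ⊢
        rw [← hYcommX, ← hXZ, hXX w w', ← map_add, h1, map_smul]
      · rw [← hXZ, h2, map_smul]
    · refine ⟨?_, ?_⟩
      · simp only [LinearMap.add_apply, LinearMap.comp_apply] at h1 ⊢
        rw [← hYcommZ, hZZ w w', hXZ w w', ← map_add, h1, map_smul]
      · rw [hZZ w w', h2, map_smul]
  have hcomm : ∀ A ∈ 𝒮, ∀ B ∈ 𝒮, ∀ m ∈ M, A (B m) = B (A m) := by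
    rintro A (⟨w, rfl⟩ | ⟨w, rfl⟩) B (⟨w', rfl⟩ | ⟨w', rfl⟩) m _
    · exact hXX w w' m
    · exact hXZ w w' m
    · exact (hXZ w' w m).symm
    · exact hZZ w w' m
  obtain ⟨y₀, hy₀M, hy₀, heig⟩ := exists_common_eigenvector_of_forall_comm M hM 𝒮 hstab hcomm
  -- the eigenvalues
  choose c hc using heig
  let μ : W → E := fun w => c (X w) (Or.inl ⟨w, rfl⟩)
  let ζ : W → E := fun w => c (Z w) (Or.inr ⟨w, rfl⟩)
  have hμ : ∀ w, X w y₀ = μ w • y₀ := fun w => hc (X w) (Or.inl ⟨w, rfl⟩)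
  have hζ : ∀ w, Z w y₀ = ζ w • y₀ := fun w => hc (Z w) (Or.inr ⟨w, rfl⟩)
  have hμ0 : ∀ w, μ w ≠ 0 := fun w h0 => hy₀ (injective_of_pushPull (hYX w) (hq w)
    (by rw [hμ w, h0, zero_smul, map_zero]))
  refine ⟨y₀, μ, ζ, hy₀, hμ, hζ, hμ0, Filter.mem_of_superset hS fun w hw => ?_⟩
  obtain ⟨h1, h2⟩ := (hmemM y₀).1 hy₀M w hw
  constructor
  · -- `(Z Y + X) y₀ = (q ζ μ⁻¹ + μ) y₀`
    have hval : (Z w ∘ₗ Y w + X w) y₀ = (q w * ζ w * (μ w)⁻¹ + μ w) • y₀ := by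
      rw [LinearMap.add_apply, LinearMap.comp_apply, pushPull_apply_of_eigen (hYX w) (hμ0 w) (hμ w),
        map_smul, hζ w, hμ w, smul_smul, ← add_smul]
      congr 1
      ring
    rw [hval] at h1
    exact (smul_left_injective E hy₀ h1).symm
  · rw [hζ w] at h2
    exact (smul_left_injective E hy₀ h2).symm

omit [FiniteDimensional E H] [IsAlgClosed E] in
/-- **The Hecke quadratic splits**: with `a₁ = q ζ μ⁻¹ + μ`, `a₂ = ζ` and `μ ≠ 0`,
`X² − a₁ X + q a₂ = (X − q ζ μ⁻¹)(X − μ)` — roots `q · (ζ μ⁻¹)` and `μ`. [cite: Harder1987, §2] -/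
theorem heckeQuadratic_eq_mul {q m z a₁ a₂ : E} (hm : m ≠ 0) (h₁ : a₁ = q * z * m⁻¹ + m)
    (h₂ : a₂ = z) :
    (Polynomial.X ^ 2 - Polynomial.C a₁ * Polynomial.X + Polynomial.C (q * a₂) : Polynomial E) =
      (Polynomial.X - Polynomial.C (q * z * m⁻¹)) * (Polynomial.X - Polynomial.C m) := by
  subst h₁ h₂
  have hprod : q * a₂ * m⁻¹ * m = q * a₂ := by rw [mul_assoc, inv_mul_cancel₀ hm, mul_one]
  have : (Polynomial.X - Polynomial.C (q * a₂ * m⁻¹)) * (Polynomial.X - Polynomial.C m) =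
      Polynomial.X ^ 2 - Polynomial.C (q * a₂ * m⁻¹ + m) * Polynomial.X +
        Polynomial.C (q * a₂ * m⁻¹ * m) := by
    simp only [map_add, map_mul]
    ring
  rw [this, hprod]

end Literature.NumberTheory.Automorphic
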